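import Summits.QuantumFields.BalabanUV.T4Continuum.Support.NE7SlicePoincareTAClass

/-!
# NE7SlicePoincareTASU2 — (H1) ON PRINT's SLICE `T_A` AT `d = 4`, `L = 2`, SU(2), WITH NO NUMERIC HYPOTHESIS BUT THE CLASS RADIUS `ε ≤ 10⁻⁵³`: for every `N ≥ 1`, every level `j`, every
# `W ∈ sfClass 4 2 N ε (j+1)`, every skew torus 1-form `t` with `Q̄_W t = 0`, `R D_W† t = 0`:
# `dirSq(extF t) ≤ 8·(1 + 4·(8·(2 + 6ε)²·(2·64⁴)²))·CPLine(4,2,2,10⁻¹⁷,10⁻⁵³)·M²·curlSq_W(extF t)`, `CPLine ≤ 1234·10¹⁴` — F225 with row NE3-R2's numeric lines (`lines_d4_L2_c2`, `levelSmall_family_d4_L2`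
# style) and the orbit comparison's fifth line discharged by `norm_num` (file 155 of the curved (APE), F226)

Cell `pub-balaban`, rung (B)+1 sub-cell t4, lineage `b2b-balaban-t4-ne7-p1` (CRUX PROVER NE7 #1 = OWNER of row NE7), generation 86; memo
`t4/b2b-balaban-t4-ne7-p1-g86/ORBIT-COMPARISON.md` §4.  Over F225 `NE7SlicePoincareTAClass.slicePoincare_TA_sfClass` and row NE3's `NE3ClassSlicePoincare.lines_d4_L2_c2` BY NAME.
WHAT ([folklore]; 0 def, 0 sorry).  `card_plane_four_le` (`#Plane 4 ≤ 16`), `line5_SU2` (the fifth line at `d = 4`, `L = 2`, `card n = 2`, `εc = 10⁻¹⁷`, `θ = 10⁻⁵³`, every `0 ≤ ε ≤ 10⁻⁵³`),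
**`slicePoincare_TA_SU2`**.
HONEST FRAMING (page 1): (H1) (hence (P_a), [B9] Thm 3.11 SHAPE for OUR `softSymOpKa`, in F212's regime) is a THEOREM on the SU(2), `d = 4`, `L = 2` small-field class of radius `≤ 10⁻⁵³`
(rung (B)+1, finite T⁴); the rows (C) of `cGreenSymKa` remain DISPLAYED in the END; (KL-B), (APE) on curved data NOT proved unconditionally; NOT ONE-STEP, NOT NE7; spine 0∕9; finite T⁴
rung (B)+1 — NOT infinite volume, NOT mass gap, NOT `BetaPertH`, NOT Clay.  Continuum YM on T⁴ ⇐ BetaPertH ∧ nine spine estimates (0/9 proved); BetaPertH ⇐ (D1) ∧ (D4) ∧ CAP+tail;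
G-an2-4 gates asym, D1 and NE2/3/4.
-/

set_option autoImplicit false

open scoped BigOperators InnerProductSpace Matrix Matrix.Norms.L2Operator
open Finset

namespace Summit.QuantumFields.BalabanUV.T4Continuum.NE7SlicePoincareTASU2

open Literature.MathematicalPhysics.QuantumFieldTheory.Balaban1983to89
open B7Prop1Explicit B7Prop2Explicit UnitaryModel MatrixNorms
open T4AveragingDeficitWall (IsUnitaryCfg IsSkewDir SmallField dirSq curlSq Plane)
open T4AveragingDeficitWallBoundary (periodBox IsPeriodicCfg)
open AveragingDeficitMultiLevelPrep (LevelSmall)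
open AveragingDeficitTwoLevelPrep (twoLevelSmall)
open NE3HilbertSchmidtTorus
open NE3SlicePoincareBudgetLine (CPLine)
open NE3ClassSlicePoincare (lines_d4_L2_c2 C2sq_four_two)
open NE3ClassRadiusFamily (CPLine_nonneg_d4_L2)
open MinimalActionRate (sfClass)
open NE7BalabanSoftOperator
open NE7SlicePoincareTAClass (slicePoincare_TA_sfClass)

noncomputable section

variable {n : Type*} [Fintype n] [DecidableEq n]

omit [Fintype n] [DecidableEq n] in
/-- `#Plane 4 ≤ 16`. [folklore] -/
theorem card_plane_four_le : (Fintype.card (Plane 4) : ℝ) ≤ 16 := by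
  have h : Fintype.card (Plane 4) ≤ Fintype.card (Fin 4 × Fin 4) := Fintype.card_subtype_le _
  rw [Fintype.card_prod, Fintype.card_fin] at h
  exact_mod_cast h

omit [Fintype n] [DecidableEq n] in
/-- **THE FIFTH LINE AT `d = 4`, `L = 2`, SU(2)**: for every `0 ≤ ε ≤ 10⁻⁵³`,
`32·2²·#Plane·ε²·(2 + 2(1 + 4·(2·4·(2+2·3ε)²·(2·64⁴)²)))·CPLine(4,2,2,10⁻¹⁷,10⁻⁵³) ≤ 1∕2`. [folklore] -/
theorem line5_SU2 {ε : ℝ} (hε : 0 ≤ ε) (hε' : ε ≤ 1 / 10 ^ 53) :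
    32 * (((2 : ℕ) : ℝ)) ^ 2 * (Fintype.card (Plane 4)) * ε ^ 2
      * (2 + 2 * (1 + 4 * ((((2 : ℕ) : ℝ)) * ((4 : ℕ) : ℝ) * (2 + 2 * (((((4 : ℕ) : ℝ)) - 1) * ε)) ^ 2 * (2 * (64 : ℝ) ^ (4 : ℕ)) ^ 2)))
      * CPLine 4 2 2 (1 / 10 ^ 17) (1 / 10 ^ 53) ≤ 1 / 2 := by
  obtain ⟨-, -, -, -, hCP⟩ := lines_d4_L2_c2
  have hCP0 := CPLine_nonneg_d4_L2
  have hPl := card_plane_four_le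
  have hPl0 : (0 : ℝ) ≤ Fintype.card (Plane 4) := Nat.cast_nonneg _
  have hε1 : ε ≤ 1 := hε'.trans (by norm_num)
  -- bound the bracket by a numeral using `ε ≤ 1`
  have hbr : (2 + 2 * (1 + 4 * ((((2 : ℕ) : ℝ)) * ((4 : ℕ) : ℝ) * (2 + 2 * (((((4 : ℕ) : ℝ)) - 1) * ε)) ^ 2 * (2 * (64 : ℝ) ^ (4 : ℕ)) ^ 2)))
      ≤ 2 + 2 * (1 + 4 * (2 * 4 * (2 + 2 * (3 * 1)) ^ 2 * (2 * (64 : ℝ) ^ (4 : ℕ)) ^ 2)) := by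
    push_cast
    have : (2 + 2 * ((4 - 1) * ε)) ^ 2 ≤ (2 + 2 * (3 * (1 : ℝ))) ^ 2 := by
      apply pow_le_pow_left₀ (by positivity); linarith
    nlinarith [this]
  have hε2 : ε ^ 2 ≤ (1 / 10 ^ 53) ^ 2 := pow_le_pow_left₀ hε hε' 2
  calc 32 * (((2 : ℕ) : ℝ)) ^ 2 * (Fintype.card (Plane 4)) * ε ^ 2
        * (2 + 2 * (1 + 4 * ((((2 : ℕ) : ℝ)) * ((4 : ℕ) : ℝ) * (2 + 2 * (((((4 : ℕ) : ℝ)) - 1) * ε)) ^ 2 * (2 * (64 : ℝ) ^ (4 : ℕ)) ^ 2)))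
        * CPLine 4 2 2 (1 / 10 ^ 17) (1 / 10 ^ 53)
      ≤ 32 * (((2 : ℕ) : ℝ)) ^ 2 * 16 * (1 / 10 ^ 53) ^ 2
        * (2 + 2 * (1 + 4 * (2 * 4 * (2 + 2 * (3 * 1)) ^ 2 * (2 * (64 : ℝ) ^ (4 : ℕ)) ^ 2))) * (1234 * 10 ^ 14) := by
        gcongr
    _ ≤ 1 / 2 := by norm_num

/-- **(H1) ON `T_A` FOR SU(2), `d = 4`, `L = 2`, NO NUMERIC HYPOTHESIS BUT `ε ≤ 10⁻⁵³`.**  For every `N ≥ 1`, class radius `0 < ε ≤ 10⁻⁵³`, level `j`, `W ∈ sfClass 4 2 N ε (j+1)` (read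
at `x = ε∕(2^{j+1})²` with its `LevelSmall` letter), every skew torus 1-form `t` with `Q̄_W t = 0` and `R D_W† t = 0`:
`dirSq(extF t) ≤ 8·(1 + 4·(8·(2+6ε)²·(2·64⁴)²))·CPLine(4,2,2,10⁻¹⁷,10⁻⁵³)·(2^{j+1})²·curlSq_W(extF t)`. [folklore] -/
theorem slicePoincare_TA_SU2 [Nonempty n] (hn : Fintype.card n = 2) {N : ℕ} [NeZero N] {ε : ℝ} (hε : 0 < ε) (hε' : ε ≤ 1 / 10 ^ 53)
    (j : ℕ) [NeZero (N * 2 ^ (j + 1))] {W : Site 4 → Fin 4 → (Matrix n n ℂ)ˣ} (hW : W ∈ sfClass 4 2 N ε (j + 1))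
    {x : ℝ} (hxε : x = ε / (((2 : ℕ) : ℝ) ^ (j + 1)) ^ 2) (hx : 0 ≤ x) (hs : LevelSmall 4 2 j x) (hWx : SmallField W x) :
    ∀ t : skewForms 4 n (N * 2 ^ (j + 1)), qbarOpK (N := N) (one_le_two.trans le_rfl) j hW.1 hx hs hWx t = 0 →
      landauProjK 2 N (j + 1) W
          ((LinearMap.adjoint (𝕜 := ℝ) (E := skewSecs 4 n (N * 2 ^ (j + 1))) (F := skewForms 4 n (N * 2 ^ (j + 1))) (gradOpK hW.1 (N * 2 ^ (j + 1)))
            : skewForms 4 n (N * 2 ^ (j + 1)) →ₗ[ℝ] skewSecs 4 n (N * 2 ^ (j + 1))) t) = 0 →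
      dirSq (extF (N * 2 ^ (j + 1)) (t : Form 4 n (N * 2 ^ (j + 1)))) (periodBox (d := 4) (N * 2 ^ (j + 1)))
        ≤ (4 * (((2 : ℕ) : ℝ)) * (1 + 4 * ((((2 : ℕ) : ℝ)) * ((4 : ℕ) : ℝ) * (2 + 2 * (((((4 : ℕ) : ℝ)) - 1) * ε)) ^ 2 * (2 * (64 : ℝ) ^ (4 : ℕ)) ^ 2))
            * CPLine 4 2 (((2 : ℕ) : ℝ)) (1 / 10 ^ 17) (1 / 10 ^ 53) * (((2 : ℕ) : ℝ) ^ (j + 1)) ^ 2)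
          * curlSq W (extF (N * 2 ^ (j + 1)) (t : Form 4 n (N * 2 ^ (j + 1)))) (periodBox (d := 4) (N * 2 ^ (j + 1))) := by
  obtain ⟨h1, h2, h3, h4, -⟩ := lines_d4_L2_c2
  have h5 := line5_SU2 hε.le hε'
  have hε1 : 16 * (14464 * ((((4 : ℕ) : ℝ)) + 1) ^ 2 * ((((4 : ℕ) : ℝ)) + 4) ^ 2) * ε ≤ 3 := by
    push_cast; nlinarith [hε', hε.le]
  have hε2 : 2 * twoLevelSmall 4 2 * ε ≤ (((2 : ℕ) : ℝ)) ^ 2 := by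
    unfold twoLevelSmall; push_cast; nlinarith [hε', hε.le]
  have h := slicePoincare_TA_sfClass (n := n) (d := 4) (L := 2) (N := N) (by norm_num) le_rfl (θ := 1 / 10 ^ 53) (εc := 1 / 10 ^ 17) hε hε'
    (by norm_num) hε1 hε2
  rw [hn] at h
  exact h h1 h2 h3 h4 h5 j hW hxε hx hs hWx

end

end Summit.QuantumFields.BalabanUV.T4Continuum.NE7SlicePoincareTASU2
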